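import Summits.BirchSwinnertonDyer.BirchSwinnertonDyer.Theorems.KatoDescentPotSupersingularKatoSelmerSharpBound
import Literature.NumberTheory.EllipticCurves.WeilPairingLevelDescent
import HarnessLib

/-!
# Level transports and the local Kummer conditions: maps `E[n₁] → E[n₂]` that are `P ↦ c·P` on points carry `𝓚_{n₁}` into `𝓚_{n₂}`
# (identity-on-points maps: `𝓚_{n₁} = f⁻¹ 𝓚_{n₂}`); the composite `ι′ : E[p^s·p^K] ⥲ E[p^{s+K}] ↪ E[p^∞]` and `ι′ ∘ incl = ι_K`
# (route `KatoDescentPotSupersingular` / `…Tame…`, crux M = stmt-BirchSwinnertonDyer-19196; route-free helper)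

Seat `bsd-potss-rkm` g19 (prover; cell `bsd-potss`), item stmt-BirchSwinnertonDyer-19196 (`--supports … --as helper`; closes
nothing).  HONEST FRAMING: BSD is not proved by any of this; nothing is booked; theorems only (no definition, no named fact):
TOOL theorems (Galois cohomology of the torsion of an elliptic curve).

## Why (companion (ii) of brick (a) of crux M's level-0 ledger — memo `HOME/rkm/FINDING-19196-rkm-g19.md` §"What remains")

The PT-cokernel argument runs at two levels `d = p^K` (the `X11b` spelling `((p^K:ℕ):ℤ)`, `ι_K = primaryInclusion W p K`) and
`kd = p^s·p^K` (the `WeilPairingLevelDescent` spelling `((p^s*p^K:ℕ):ℤ)`, `i = inclKD`, `[p^s] = mulK`); the top level reaches `E[p^∞]`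
through **`ι′ := (primaryInclusion W p (s+K)) ∘ (torsionInclusion : E[((p^s*p^K:ℕ):ℤ)] ⥲ E[((p^{s+K}:ℕ):ℤ)])`** (Mathlib `ContIntertwiningMap.comp`;
identity on points).  This file supplies the bookkeeping:

* §1 (any field `K`, any `K`-field `E`, any intertwining `f : E[n₁] → E[n₂]` which is `P ↦ c·P` on points):
  `map_torsionPointsMap_map_eq_nsmul` (`(E[n₂] ↪ E)_* f_* z = c·(E[n₁] ↪ E)_* z` on `H¹(Γ_E,·)`), hence
  **`map_mem_kummerLocalConditionAt_of_coe_eq_smul`** (`f_* 𝓚_{n₁} ⊆ 𝓚_{n₂}`) and, for `c = 1`,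
  **`mem_kummerLocalConditionAt_iff_map_mem_of_coe_eq`** (`𝓚_{n₁} = f⁻¹ 𝓚_{n₂}`); `map_comp_restrictField_one_apply` / `map_comp_one_apply`
  (`(f ∘ g)_* = f_* ∘ g_*` on `H¹`, cocycle-level).
* §2 (elliptic `W` over a number field, prime `p`, `s K : ℕ`): `natCast_pow_mul_pow_dvd` (`p^s·p^K ∣ p^{s+K}` in `ℤ`);
  **`map_iotaPrime_map_inclKD`** (`ι′_* i_* = (ι_K)_*`, global and local); **`kummerLocalConditionAt_le_ker_map_iotaPrime`** (at `v ∤ p`: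
  `𝓚_{kd,v} ≤ ker ι′_*`, X11b torsion saturation at level `p^{s+K}`); **`map_iotaPrime_mem_selmerLocalKerPrimary`** (a level-`kd` class Kummer at `v`
  maps into the `p^∞` Kummer condition `selmerLocalKerPrimary`, via part 36 at level `p^{s+K}`); `map_mulK_mem_kummerLocalConditionAt`,
  `map_inclKD_mem_kummerLocalConditionAt` (`[p^s]_*`, `i_*` preserve the local Kummer conditions).

References: J. H. Silverman, *AEC* VIII §2, X §4 [SilvermanAEC2009]; J. S. Milne, *ADT* I §6 [MilneADT2006]; R. Greenberg, LNM 1716 §5 [GreenbergLNM1716].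
-/

-- the summit and its single problem are both named `BirchSwinnertonDyer` (registry layout D-0017)
set_option linter.dupNamespace false
set_option autoImplicit false

noncomputable section

open scoped Classical ContRepresentation NumberField
open CategoryTheory Function Field NumberField IsDedekindDomain WeierstrassCurve
open Literature.NumberTheory.EllipticCurves Literature.NumberTheory.GaloisRepresentations
  Literature.NumberTheory.GaloisRepresentations.DiscreteGaloisModule Literature.NumberTheory.GaloisCohomology
open Summit.BirchSwinnertonDyer.Rank1Residual.X11b.Levels Summit.BirchSwinnertonDyer.Rank1Residual.X11b.LocBridge
  Summit.BirchSwinnertonDyer.Rank1Residual.X11b.LevelKummer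
open Summit.BirchSwinnertonDyer.Rank1Residual.GaloisImage

universe u

namespace Summit.BirchSwinnertonDyer.BirchSwinnertonDyer.Theorems.KatoFiniteLevelCount

/-! ## §1 Generic: maps that are `P ↦ c·P` on points and the local Kummer conditions; `(f ∘ g)_*` on `H¹` -/

section Generic

variable {K : Type u} [Field K] {M₁ M₂ M₃ : Type u}
  [AddCommGroup M₁] [TopologicalSpace M₁] [DiscreteTopology M₁]
  [AddCommGroup M₂] [TopologicalSpace M₂] [DiscreteTopology M₂]
  [AddCommGroup M₃] [TopologicalSpace M₃] [DiscreteTopology M₃]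
  {ρ₁ : DiscreteGaloisModule K M₁} {ρ₂ : DiscreteGaloisModule K M₂} {ρ₃ : DiscreteGaloisModule K M₃}

/-- **`(f ∘ g)_* = f_* ∘ g_*` on `H¹(K, ·)`** for continuous intertwining maps of discrete Galois modules (cocycle-level). [folklore] -/
theorem map_comp_one_apply (f : ρ₂.toContRepresentation →ⁱL ρ₃.toContRepresentation)
    (g : ρ₁.toContRepresentation →ⁱL ρ₂.toContRepresentation) (z : galoisCohomology ρ₁ 1) :
    galoisCohomology.map (f.comp g) 1 z = galoisCohomology.map f 1 (galoisCohomology.map g 1 z) := by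
  obtain ⟨φ, rfl⟩ := oneCocycleClass_surjective _ z
  rw [galoisCohomology.map_one_oneCocycleClass, galoisCohomology.map_one_oneCocycleClass,
    galoisCohomology.map_one_oneCocycleClass]
  rfl

/-- **`(f ∘ g)_* = f_* ∘ g_*` on `H¹(Γ_E, ·)`** for the restrictions to a `K`-field `E`. [folklore] -/
theorem map_comp_restrictField_one_apply (E : Type u) [Field E] [Algebra K E]
    (f : ρ₂.toContRepresentation →ⁱL ρ₃.toContRepresentation) (g : ρ₁.toContRepresentation →ⁱL ρ₂.toContRepresentation)
    (z : galoisCohomology (GaloisRep.restrictField E ρ₁) 1) :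
    galoisCohomology.map ((f.comp g).restrictField E) 1 z =
      galoisCohomology.map (f.restrictField E) 1 (galoisCohomology.map (g.restrictField E) 1 z) := by
  obtain ⟨φ, rfl⟩ := oneCocycleClass_surjective _ z
  rw [galoisCohomology.map_one_oneCocycleClass, galoisCohomology.map_one_oneCocycleClass,
    galoisCohomology.map_one_oneCocycleClass]
  rfl

variable (W : WeierstrassCurve K) {n₁ n₂ : ℤ} (E : Type u) [Field E] [Algebra K E]
  (f : (W.torsionGaloisModule n₁).toContRepresentation →ⁱL (W.torsionGaloisModule n₂).toContRepresentation)

/-- **`(E[n₂] ↪ E)_* (f_* z) = c · (E[n₁] ↪ E)_* z` in `H¹(Γ_E, E(K̄_E))`** for an intertwining `f : E[n₁] → E[n₂]` that is `P ↦ c·P` on points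
(e.g. `mulK`, `c = k`; the level transports `torsionInclusion`/`inclKD`, `c = 1`). [cite: SilvermanAEC2009, VIII §2] -/
theorem map_torsionPointsMap_map_eq_nsmul (c : ℕ) (hf : ∀ P : geomTorsion W n₁, ((f P : geomTorsion W n₂) : geomPoints W) = (c : ℤ) • (P : geomPoints W))
    (z : galoisCohomology (GaloisRep.restrictField E (W.torsionGaloisModule n₁)) 1) :
    galoisCohomology.map (W.torsionPointsMapIntertwining n₂ E) 1 (galoisCohomology.map (f.restrictField E) 1 z) =
      c • galoisCohomology.map (W.torsionPointsMapIntertwining n₁ E) 1 z := by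
  obtain ⟨φ, rfl⟩ := oneCocycleClass_surjective _ z
  rw [galoisCohomology.map_one_oneCocycleClass, galoisCohomology.map_one_oneCocycleClass,
    galoisCohomology.map_one_oneCocycleClass]
  trans oneCocycleClass (W.localGaloisModule E).toTopRep ((c : ℤ) •
    contOneCocycles.pullback (ContinuousMonoidHom.id (absoluteGaloisGroup E))
      (X := DiscreteGaloisModule.toTopRep (GaloisRep.restrictField E (W.torsionGaloisModule n₁)))
      (Y := (W.localGaloisModule E).toTopRep)
      (TopRep.ofHom ⟨(W.torsionPointsMapIntertwining n₁ E).toContinuousLinearMap,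
        (W.torsionPointsMapIntertwining n₁ E).isIntertwining'⟩) φ)
  · refine congrArg _ (Subtype.ext (ContinuousMap.ext fun σ ↦ ?_))
    change pointsMap W E ((f (φ.1 σ) : geomTorsion W n₂) : geomPoints W) =
      (c : ℤ) • pointsMap W E ((φ.1 σ : geomTorsion W n₁) : geomPoints W)
    rw [hf, map_zsmul]
  · rw [oneCocycleClass_smul, Nat.cast_smul_eq_nsmul]
    rfl

/-- **`f_* 𝓚_{n₁} ⊆ 𝓚_{n₂}`**: an intertwining `f : E[n₁] → E[n₂]` which is `P ↦ c·P` on points maps the local Kummer condition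
(`= ker (H¹(Γ_E,E[n]) → H¹(Γ_E,E))`) at level `n₁` into that at level `n₂`. [cite: SilvermanAEC2009, X §4 diagram (**)] -/
theorem map_mem_kummerLocalConditionAt_of_coe_eq_smul (c : ℕ)
    (hf : ∀ P : geomTorsion W n₁, ((f P : geomTorsion W n₂) : geomPoints W) = (c : ℤ) • (P : geomPoints W))
    {z : galoisCohomology (GaloisRep.restrictField E (W.torsionGaloisModule n₁)) 1} (hz : z ∈ W.kummerLocalConditionAt n₁ E) :
    galoisCohomology.map (f.restrictField E) 1 z ∈ W.kummerLocalConditionAt n₂ E := by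
  rw [mem_kummerLocalConditionAt_iff] at hz ⊢
  rw [map_torsionPointsMap_map_eq_nsmul W E f c hf, hz, smul_zero]

/-- **`𝓚_{n₁} = f⁻¹ 𝓚_{n₂}`** for an intertwining `f : E[n₁] → E[n₂]` that is the IDENTITY on points (a level transport such as
`torsionInclusion`). [cite: SilvermanAEC2009, X §4 diagram (**)] -/
theorem mem_kummerLocalConditionAt_iff_map_mem_of_coe_eq
    (hf : ∀ P : geomTorsion W n₁, ((f P : geomTorsion W n₂) : geomPoints W) = (P : geomPoints W))
    (z : galoisCohomology (GaloisRep.restrictField E (W.torsionGaloisModule n₁)) 1) :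
    z ∈ W.kummerLocalConditionAt n₁ E ↔ galoisCohomology.map (f.restrictField E) 1 z ∈ W.kummerLocalConditionAt n₂ E := by
  rw [mem_kummerLocalConditionAt_iff, mem_kummerLocalConditionAt_iff,
    map_torsionPointsMap_map_eq_nsmul W E f 1 (fun P => by rw [hf, Nat.cast_one, one_smul]), one_smul]

end Generic

/-! ## §2 The elliptic-curve instances: `[p^s]`, `i = inclKD`, and `ι′ = primaryInclusion (s+K) ∘ torsionInclusion` -/

section Elliptic

variable {K : Type u} [Field K] (W : WeierstrassCurve K) (p s k : ℕ)

omit W in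
/-- `p^s·p^k ∣ p^{s+k}` in `ℤ` (indeed equal: `pow_add`) — the divisibility consumed by `torsionInclusion` to transport between the two level
spellings `((p^s*p^k : ℕ) : ℤ)` (`WeilPairingLevelDescent`) and `((p^(s+k) : ℕ) : ℤ)` (`X11b`). [folklore] -/
theorem natCast_pow_mul_pow_dvd_natCast_pow_add : ((p ^ s * p ^ k : ℕ) : ℤ) ∣ ((p ^ (s + k) : ℕ) : ℤ) :=
  ⟨1, by rw [mul_one, pow_add]⟩

variable (E : Type u) [Field E] [Algebra K E]

/-- **`[p^s]_*` preserves the local Kummer conditions**: `(mulK)_* 𝓚_{p^s p^k} ⊆ 𝓚_{p^k}` (`mulK` is `P ↦ p^s·P` on points).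
[cite: SilvermanAEC2009, X §4 diagram (**)] -/
theorem map_mulK_mem_kummerLocalConditionAt {z : galoisCohomology (GaloisRep.restrictField E (W.torsionGaloisModule ((p ^ s * p ^ k : ℕ) : ℤ))) 1}
    (hz : z ∈ W.kummerLocalConditionAt ((p ^ s * p ^ k : ℕ) : ℤ) E) :
    galoisCohomology.map ((mulK W (p ^ s) (p ^ k)).restrictField E) 1 z ∈ W.kummerLocalConditionAt ((p ^ k : ℕ) : ℤ) E :=
  map_mem_kummerLocalConditionAt_of_coe_eq_smul W E (mulK W (p ^ s) (p ^ k)) (p ^ s) (fun P => coe_mulK_apply W (p ^ s) (p ^ k) P) hz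

/-- **`i_*` preserves the local Kummer conditions, both ways**: `𝓚_{p^k} = (inclKD)⁻¹ 𝓚_{p^s p^k}` (`inclKD` is the identity on points).
[cite: SilvermanAEC2009, X §4 diagram (**)] -/
theorem mem_kummerLocalConditionAt_iff_map_inclKD_mem
    (z : galoisCohomology (GaloisRep.restrictField E (W.torsionGaloisModule ((p ^ k : ℕ) : ℤ))) 1) :
    z ∈ W.kummerLocalConditionAt ((p ^ k : ℕ) : ℤ) E ↔
      galoisCohomology.map ((inclKD W (p ^ s) (p ^ k)).restrictField E) 1 z ∈ W.kummerLocalConditionAt ((p ^ s * p ^ k : ℕ) : ℤ) E :=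
  mem_kummerLocalConditionAt_iff_map_mem_of_coe_eq W E (inclKD W (p ^ s) (p ^ k)) (fun P => coe_inclKD_apply W (p ^ s) (p ^ k) P) z

/-- **`𝓚_{p^s p^k} = (torsionInclusion)⁻¹ 𝓚_{p^{s+k}}`** for the identity-on-points transport between the two level spellings.
[cite: SilvermanAEC2009, X §4 diagram (**)] -/
theorem mem_kummerLocalConditionAt_iff_map_torsionInclusion_mem
    (z : galoisCohomology (GaloisRep.restrictField E (W.torsionGaloisModule ((p ^ s * p ^ k : ℕ) : ℤ))) 1) :
    z ∈ W.kummerLocalConditionAt ((p ^ s * p ^ k : ℕ) : ℤ) E ↔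
      galoisCohomology.map ((W.torsionInclusion (natCast_pow_mul_pow_dvd_natCast_pow_add p s k)).restrictField E) 1 z ∈
        W.kummerLocalConditionAt ((p ^ (s + k) : ℕ) : ℤ) E :=
  mem_kummerLocalConditionAt_iff_map_mem_of_coe_eq W E _ (fun P => W.coe_torsionInclusion_apply _ P) z

/-- **`ι′_* i_* = (ι_K)_*` on `H¹(K, ·)`** for `ι′ = primaryInclusion (s+k) ∘ torsionInclusion : E[p^s p^k] → E[p^∞]` and `i = inclKD : E[p^k] → E[p^s p^k]`
(all three maps are the identity on points). [cite: GreenbergLNM1716, §5 proof of Prop. 5.8] -/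
theorem map_iotaPrime_map_inclKD (z : galoisCohomology (W.torsionGaloisModule ((p ^ k : ℕ) : ℤ)) 1) :
    galoisCohomology.map ((primaryInclusion W p (s + k)).comp (W.torsionInclusion (natCast_pow_mul_pow_dvd_natCast_pow_add p s k))) 1
        (galoisCohomology.map (inclKD W (p ^ s) (p ^ k)) 1 z) =
      galoisCohomology.map (primaryInclusion W p k) 1 z := by
  obtain ⟨φ, rfl⟩ := oneCocycleClass_surjective _ z
  rw [galoisCohomology.map_one_oneCocycleClass, galoisCohomology.map_one_oneCocycleClass,
    galoisCohomology.map_one_oneCocycleClass]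
  refine congrArg _ (Subtype.ext (ContinuousMap.ext fun σ ↦ Subtype.ext ?_))
  rfl

/-- **`ι′_* i_* = (ι_K)_*` on `H¹(Γ_E, ·)`** (restricted maps). [cite: GreenbergLNM1716, §5 proof of Prop. 5.8] -/
theorem map_iotaPrime_map_inclKD_restrictField
    (z : galoisCohomology (GaloisRep.restrictField E (W.torsionGaloisModule ((p ^ k : ℕ) : ℤ))) 1) :
    galoisCohomology.map (((primaryInclusion W p (s + k)).comp
        (W.torsionInclusion (natCast_pow_mul_pow_dvd_natCast_pow_add p s k))).restrictField E) 1
        (galoisCohomology.map ((inclKD W (p ^ s) (p ^ k)).restrictField E) 1 z) =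
      galoisCohomology.map ((primaryInclusion W p k).restrictField E) 1 z := by
  obtain ⟨φ, rfl⟩ := oneCocycleClass_surjective _ z
  rw [galoisCohomology.map_one_oneCocycleClass, galoisCohomology.map_one_oneCocycleClass,
    galoisCohomology.map_one_oneCocycleClass]
  refine congrArg _ (Subtype.ext (ContinuousMap.ext fun σ ↦ Subtype.ext ?_))
  rfl

variable [NumberField K] [W.IsElliptic] [Fact p.Prime]

/-- **At a finite place `v ∤ p`: `𝓚_{p^s p^k, v} ≤ ker ι′_*`** (`ι′ = primaryInclusion (s+k) ∘ torsionInclusion`): a Kummer class at level `p^s p^k`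
transports to a Kummer class at level `p^{s+k}` (§1), which dies in `H¹(K_v, E[p^∞])` (X11b torsion saturation
`kummerLocalConditionAt_eq_ker_map_primaryInclusion`). [cite: JetchevSkinnerWan2017, §2.2.3 (arXiv:1512.06894 p. 7)] [cite: SilvermanAEC2009, Prop. VII.6.3] -/
theorem kummerLocalConditionAt_le_ker_map_iotaPrime (v : HeightOneSpectrum (𝓞 K)) (hpv : ((p : ℕ) : 𝓞 K) ∉ v.asIdeal) :
    W.kummerLocalConditionAt ((p ^ s * p ^ k : ℕ) : ℤ) (v.adicCompletion K) ≤
      (galoisCohomology.map (((primaryInclusion W p (s + k)).comp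
        (W.torsionInclusion (natCast_pow_mul_pow_dvd_natCast_pow_add p s k))).restrictField (v.adicCompletion K)) 1).ker := by
  intro z hz
  have hn : ((p ^ (s + k) : ℕ) : ℤ) ≠ 0 := Int.natCast_ne_zero.mpr (pow_ne_zero _ (Fact.out : p.Prime).ne_zero)
  rw [AddMonoidHom.mem_ker, map_comp_restrictField_one_apply, ← AddMonoidHom.mem_ker,
    ← kummerLocalConditionAt_eq_ker_map_primaryInclusion W p (s + k) v hpv hn]
  exact (mem_kummerLocalConditionAt_iff_map_torsionInclusion_mem W p s k (v.adicCompletion K) z).1 hz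

omit [W.IsElliptic] [Fact p.Prime] in
/-- **A level-`p^s p^k` class which is Kummer at `v` maps under `ι′` into the `p^∞` Kummer condition at `v`** (`selmerLocalKerPrimary`, "dies in
`H¹(K_v, E)`"): transport to level `p^{s+k}` (§1) and part 36's `localization_mem_kummerSelmerStructure_iff_map_primaryInclusion_mem`.
[cite: SilvermanAEC2009, X §4 diagram (**)] [cite: GreenbergLNM1716, §2 p. 63] -/
theorem map_iotaPrime_mem_selmerLocalKerPrimary (v : Place K)
    {x : galoisCohomology (W.torsionGaloisModule ((p ^ s * p ^ k : ℕ) : ℤ)) 1}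
    (hx : galoisCohomology.localization (W.torsionGaloisModule ((p ^ s * p ^ k : ℕ) : ℤ)) v 1 x ∈
      W.kummerSelmerStructure ((p ^ s * p ^ k : ℕ) : ℤ) v) :
    galoisCohomology.map ((primaryInclusion W p (s + k)).comp
        (W.torsionInclusion (natCast_pow_mul_pow_dvd_natCast_pow_add p s k))) 1 x ∈
      selmerLocalKerPrimary W (Place.Completion v) p := by
  rw [map_comp_one_apply, ← localization_mem_kummerSelmerStructure_iff_map_primaryInclusion_mem, localization_map_one']
  exact (mem_kummerLocalConditionAt_iff_map_torsionInclusion_mem W p s k (Place.Completion v) _).1 hx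

end Elliptic

end Summit.BirchSwinnertonDyer.BirchSwinnertonDyer.Theorems.KatoFiniteLevelCount

end
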